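import Summits.QuantumFields.YangMills.Theses.DyadicChessboard
import Summits.QuantumFields.YangMills.Theorems.DyadicChessboardChessboardTransferArray
import HarnessLib

/-!
# Route `DyadicChessboard` (planner ym-idea-11 g9, LINE 1 «wuc»), support item `ChessboardTransfer`
# (stmt-QuantumFields-23370), PROVED

`DyadicArrayCeiling → DyadicCeilingsFac`: K1's one-body array ceilings on the dyadic tori `(ℤ/2^m)⁴` imply the
per-order factorial ceilings `|E ∏ᵢ (plane(qᵢ, xᵢ) − E plane)| ≤ (C n^κ/R⁴)ⁿ` for `n` plaquettes pairwise `≥ 2R + 4`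
apart (`8R + 16 ≤ 2^m`, `m ≥ m₀(β)`, `R·s ≤ ℓ₄`), with `κ = 4`.

Proof (the planner's plan, in substance).  Constants: `C = 16⁴·max(C₁, 2·max(C_P, 1))` (`C₁` = K1's constant,
`C_P` = a uniform bound of the single-plane fields), `ℓ₄` = K1's, `β₄' = max(β₄, 0)` (reflection positivity needs
`β ≥ 0`), `m₀` = K1's.  For `R < 16 n` the trivial bound `(2 C_P)ⁿ ≤ (C n⁴/R⁴)ⁿ`.  For `R ≥ 16 n` take the dyadic cell
side `2^e ≤ R < 2^(e+1)`: then `e + 1 ≤ m`, `2^e·s ≤ ℓ₄`, `N = 2^(m−e)` is even, points `≥ 2R + 4 ≥ 2^e` apart lie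
in distinct cells for every offset, and the margin `δ = ⌊2^e/(4n)⌋ ≥ 2` is reached simultaneously for all points by
a common offset (pigeonhole per coordinate: each point forbids `≤ 2δ − 1` residues, `n(2δ − 1) < 2^e`), which costs
nothing by translation invariance.  In parity-normalised in-cell coordinates the shifted points are reflected-array
sites of K1's `site` formula, the reflected centred plaquettes form a coherent array for the `4·N` commuting link
reflections through the cell faces (electric plaquettes hang one unit lower, exactly K1's `N − 1 − p − [k ∈ q]`),
localised in the positive half-tori, and the Fröhlich–Israel–Lieb–Simon chessboard estimate bounds the centred moment
by the geometric mean of the full arrays — which are K1's products, `≤ (C₁/δ⁴)^(N⁴)` each.  Hence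
`|E∏| ≤ (C₁/δ⁴)ⁿ ≤ (16⁴ C₁ n⁴/R⁴)ⁿ` (`R < 16 n δ`).  The chessboard step is
`Transfer.abs_integral_prod_centred_le_of_array`; the engine is width seat w3's `WilsonChessboardRP` /
`PlaneReflection` + Literature `ChessboardEstimateObservables`.

HONEST FRAMING: the crux K1 `DyadicArrayCeiling` (stmt-QuantumFields-23368) and K2 `OddDyadicCoincidence` are OPEN;
this closes a SUPPORT item only; no crux, no rung (R2a is a RECORD rung) and no summit is proved, and the Yang–Mills
mass gap is NOT proved by any of this.  Cell `ym-idea-1`, width seat `ym-line-sfw-p2-w5` g12 (free hands).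
THEOREMS ONLY, definition-free.  References: Fröhlich–Israel–Lieb–Simon, CMP 62 (1978) Thm 4.1/4.3;
Friedli–Velenik (2017) Thm 10.11; Biskup (2009) Thm 5.8.
-/

set_option autoImplicit false

noncomputable section

namespace Summit.QuantumFields.YangMills.Theorems.DyadicChessboard

open MeasureTheory
open Literature.MathematicalPhysics.QuantumFieldTheory Literature.MathematicalPhysics.QuantumLattice
open Summit.QuantumFields.YangMills.Cruxes.OSLegsFromFemtoAndGap.DlrCollarTransfer (plane exists_abs_plane_le)
open Summit.QuantumFields.YangMills.Theorems.DyadicChessboard.Cells (exists_cells)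
open Summit.QuantumFields.YangMills.Theorems.DyadicChessboard.Transfer

/-- **Support item `ChessboardTransfer` (stmt-QuantumFields-23370) holds**: K1 `DyadicArrayCeiling` implies the
per-order factorial ceilings `|E ∏ᵢ (plane(qᵢ, xᵢ) − E plane)| ≤ (C n⁴/R⁴)ⁿ` on the dyadic tori `(ℤ/2^m)⁴` for `n`
plaquettes pairwise `≥ 2R + 4` apart, with `κ = 4`, `C = 16⁴·max(C₁, 2·max(C_P, 1))` (`C₁` = K1's constant,
`C_P` = the sup of the plane fields), `ℓ₄` = K1's and `β₄' = max(β₄, 0)`.  Proof: for `R < 16 n` the trivial bound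
`(2 C_P)ⁿ`; otherwise take the dyadic cell side `2^e ≤ R < 2^{e+1}` (so `e + 1 ≤ m`, `2^e s ≤ ℓ₄`, distinct cells for
separated points), the margin `δ = ⌊2^e/(4n)⌋ ≥ 2` reached by a common offset (pigeonhole, translation invariance),
and the Fröhlich–Israel–Lieb–Simon chessboard estimate for the coherent array of reflected centred plaquettes, whose
arrays are exactly K1's products: `|E∏| ≤ (C₁/δ⁴)ⁿ ≤ (16⁴ C₁ n⁴/R⁴)ⁿ`.  HONEST FRAMING: K1 (stmt-QuantumFields-23368)
is OPEN; this closes a support item only; no crux, no rung (R2a is a RECORD rung) and no summit is proved, and the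
Yang–Mills mass gap is NOT proved by any of this. [cite: FrohlichIsraelLiebSimon1978, Thm 4.1 and Thm 4.3] -/
theorem chessboardTransfer_proof : Summit.QuantumFields.YangMills.Theses.DyadicChessboard.ChessboardTransfer := by
  intro hK1 G _ _ _ _ hG hSU2
  dsimp only
  intro r v f g h Λ₅
  have hK0 := hK1 G hG hSU2
  dsimp only at hK0
  obtain ⟨ε₀, hε₀, hK⟩ := hK0 r v f g h Λ₅
  refine ⟨ε₀, hε₀, fun ε hε hεle hfl => ?_⟩
  obtain ⟨C₁, ℓ₄, β₄, hℓ₄, hC₁, hKβ⟩ := hK ε hε hεle hfl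
  letI : MeasurableSpace G := borel G
  haveI : BorelSpace G := ⟨rfl⟩
  obtain ⟨Cp, hCp⟩ := exists_abs_plane_le r
  set Cq : ℝ := max Cp 1 with hCq
  have hCq1 : 1 ≤ Cq := le_max_right _ _
  have hCpq : ∀ (q' : Fin 4 × Fin 4) (y : Fin 4 → ℤ) (U : LGConfig 4 G), |plane G r q' y U| ≤ Cq :=
    fun q' y U => (hCp q' y U).trans (le_max_left _ _)
  set Cbig : ℝ := 16 ^ 4 * max C₁ (2 * Cq) with hCbig
  refine ⟨Cbig, 4, ℓ₄, max β₄ 0, hℓ₄, by positivity, by norm_num, fun β hβ => ?_⟩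
  obtain ⟨m₀, hm₀⟩ := hKβ β (le_of_max_le_left hβ)
  have hβ0 : (0 : ℝ) ≤ β := le_of_max_le_right hβ
  refine ⟨m₀, fun s hs hs1 hnofl m n q x R hq hR hRs hRm hm₀m hsep => ?_⟩
  have hKm := hm₀ s hs hs1 hnofl
  haveI hL0 : NeZero (2 ^ m) := ⟨pow_ne_zero m two_ne_zero⟩
  -- the exponent `κ = 4`
  rw [show ((n : ℝ) ^ (4 : ℝ)) = (n : ℝ) ^ (4 : ℕ) by exact_mod_cast Real.rpow_natCast (n : ℝ) 4]
  have hRpos : (0 : ℝ) < R := by exact_mod_cast hR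
  -- the trivial bound
  have htriv := abs_integral_prod_centred_le_pow r (2 ^ m) β q x hCpq
  rcases Nat.eq_zero_or_pos n with hn0 | hnpos
  · subst hn0; simpa using htriv
  by_cases hsmall : R < 16 * n
  · refine htriv.trans (pow_le_pow_left₀ (by positivity) ?_ n)
    rw [le_div_iff₀ (by positivity)]
    have hR16 : (R : ℝ) ≤ 16 * n := by exact_mod_cast hsmall.le
    have hmax : 2 * Cq ≤ max C₁ (2 * Cq) := le_max_right _ _
    calc 2 * Cq * (R : ℝ) ^ 4 ≤ 2 * Cq * (16 * (n : ℝ)) ^ 4 :=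
          mul_le_mul_of_nonneg_left (pow_le_pow_left₀ hRpos.le hR16 4) (by positivity)
      _ ≤ max C₁ (2 * Cq) * (16 * (n : ℝ)) ^ 4 := mul_le_mul_of_nonneg_right hmax (by positivity)
      _ = Cbig * (n : ℝ) ^ 4 := by rw [hCbig]; ring
  -- main case `16 n ≤ R`: dyadic cells of side `2^e ≤ R < 2^(e+1)`
  push Not at hsmall
  obtain ⟨e, heR, hRe⟩ : ∃ e : ℕ, 2 ^ e ≤ R ∧ R < 2 ^ (e + 1) :=
    ⟨Nat.log 2 R, Nat.pow_log_le_self 2 (by omega), Nat.lt_pow_succ_log_self (by norm_num) R⟩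
  have hRe' : R < 2 * 2 ^ e := by rw [pow_succ] at hRe; omega
  have hlt_m : 2 ^ (e + 1) < 2 ^ m := by omega
  have hem' : e + 1 < m := (Nat.pow_lt_pow_iff_right (by norm_num)).1 hlt_m
  have hem : e + 1 ≤ m := hem'.le
  have hNB : 2 ^ m = 2 ^ (m - e) * 2 ^ e := by rw [← pow_add, Nat.sub_add_cancel (by omega)]
  haveI : NeZero (2 ^ (m - e)) := ⟨pow_ne_zero _ two_ne_zero⟩
  haveI : NeZero (2 ^ e) := ⟨pow_ne_zero _ two_ne_zero⟩
  have hN2 : 2 ≤ 2 ^ (m - e) := by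
    calc 2 = 2 ^ 1 := by norm_num
      _ ≤ 2 ^ (m - e) := Nat.pow_le_pow_right (by norm_num) (by omega)
  have hNeven : Even (2 ^ (m - e)) := (Nat.even_pow).2 ⟨even_two, by omega⟩
  have hBR' : 2 ^ e ≤ 2 * R + 4 := by omega
  -- the margin `δ = ⌊2^e / (4n)⌋`
  set δ : ℕ := 2 ^ e / (4 * n) with hδ
  have h4n : 0 < 4 * n := by omega
  have hδ1 : 1 ≤ δ := (Nat.le_div_iff_mul_le h4n).2 (by omega)
  have hδmul : δ * (4 * n) ≤ 2 ^ e := Nat.div_mul_le_self _ _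
  have hδlt : 2 ^ e < δ * (4 * n) + 4 * n := Nat.lt_div_mul_add h4n
  have h4nδ : 4 * n ≤ δ * (4 * n) := Nat.le_mul_of_pos_left _ hδ1
  have hBpos : 1 ≤ 2 ^ e := Nat.one_le_two_pow
  have hcard : n * (2 * δ - 1) < 2 ^ e := by
    have h1 : n * (2 * δ - 1) ≤ n * (2 * δ) := Nat.mul_le_mul_left _ (Nat.sub_le _ _)
    have h2 : n * (2 * δ) * 2 = δ * (4 * n) := by ring
    omega
  -- cells, offset and parity-normalised positions
  obtain ⟨t, cell, p, hinj, hmarg, hsiteY⟩ :=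
    exists_cells (L := 2 ^ m) (N := 2 ^ (m - e)) (B := 2 ^ e) hNB hN2 q x hBR' hsep δ hδ1 hcard
  have hp1 : ∀ i k, p i k + (if k = (q i).1 ∨ k = (q i).2 then 1 else 0) + 1 ≤ 2 ^ e := by
    intro i k; have := hmarg i k; omega
  -- K1's hypotheses for the arrays
  have h2es : (2 : ℝ) ^ e * s ≤ ℓ₄ := by
    have : (2 : ℝ) ^ e ≤ R := by exact_mod_cast heR
    exact (mul_le_mul_of_nonneg_right this hs.le).trans hRs
  set A : ℝ := C₁ / (δ : ℝ) ^ 4 with hA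
  have hA0 : 0 ≤ A := by positivity
  -- index change `(Fin 4 → ℤ/N) ≃ (Fin 4 → Fin N)`
  let eZF : (Fin 4 → ZMod (2 ^ (m - e))) ≃ (Fin 4 → Fin (2 ^ (m - e))) :=
    { toFun := fun c k => ⟨(c k).val, ZMod.val_lt _⟩
      invFun := fun j k => ((j k : ℕ) : ZMod (2 ^ (m - e)))
      left_inv := fun c => funext fun k => by simp
      right_inv := fun j => funext fun k => Fin.ext (by simp [ZMod.val_natCast, Nat.mod_eq_of_lt (j k).isLt]) }
  -- the chessboard step
  have hmain := abs_integral_prod_centred_le_of_array r hβ0 (L := 2 ^ m) (N := 2 ^ (m - e)) (B := 2 ^ e) hNB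
    hNeven q hq p hp1
    (fun i c k => (((c k).val : ℕ) : ℤ) * ((2 ^ e : ℕ) : ℤ) + (if Even (c k).val then (p i k : ℤ)
      else ((2 ^ e : ℕ) : ℤ) - 1 - (p i k : ℤ) - (if k = (q i).1 ∨ k = (q i).2 then 1 else 0)))
    (fun _ _ _ => rfl) cell hinj (fun i => x i + t) hsiteY hA0 (by
      intro i
      have hKi := hKm m e (q i) (p i) δ (hq i) hδ1 h2es hem hm₀m (hmarg i)
      refine le_of_eq_of_le ?_ hKi
      refine integral_congr_ae (Filter.Eventually.of_forall fun U => ?_)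
      exact Fintype.prod_equiv eZF _ _ (fun c => rfl))
  -- undo the offset and compare the constants
  rw [← integral_prod_centred_translate r (2 ^ m) β q x t]
  refine hmain.trans (pow_le_pow_left₀ hA0 ?_ n)
  have h16 : 16 * n * δ = 4 * (δ * (4 * n)) := by ring
  have hRlt' : R < 16 * n * δ := by omega
  have hRlt : (R : ℝ) ≤ 16 * (n : ℝ) * (δ : ℝ) := by exact_mod_cast hRlt'.le
  have hδpos : (0 : ℝ) < δ := by exact_mod_cast hδ1
  rw [hA, div_le_div_iff₀ (by positivity) (by positivity)]
  have hmax : C₁ ≤ max C₁ (2 * Cq) := le_max_left _ _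
  calc C₁ * (R : ℝ) ^ 4 ≤ C₁ * (16 * (n : ℝ) * δ) ^ 4 :=
        mul_le_mul_of_nonneg_left (pow_le_pow_left₀ hRpos.le hRlt 4) hC₁
    _ ≤ max C₁ (2 * Cq) * (16 * (n : ℝ) * δ) ^ 4 := mul_le_mul_of_nonneg_right hmax (by positivity)
    _ = Cbig * (n : ℝ) ^ 4 * (δ : ℝ) ^ 4 := by rw [hCbig]; ring

end Summit.QuantumFields.YangMills.Theorems.DyadicChessboard

end
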